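import Literature.NumberTheory.GaloisRepresentations.LocalGlobalCohomology
import Literature.NumberTheory.GaloisRepresentations.ContinuousH1
import Literature.NumberTheory.GaloisRepresentations.ToLocalRestrictField
import HarnessLib

/-!
# T1 JET (cell `bsd-jet`), road K: the functoriality of restriction on local cohomology (gap G2)
# PROVED — `loc_{w'} ∘ res_{L/K} = r ∘ loc_v` for a place `w' ∣ v` — and the transverse family with
# (sibling corollary) its reconciliation `hT` for the H63 assembly at inert Kolyvagin primes

HONEST FRAMING (programme file §HONESTY, verbatim): «no tranche here proves BSD; ARM L moves the
LITERAL column of an r ≤ 1 census into the kernel-proved-modulo-named-print column.» THEOREMS ONLY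
(seat `bsd-jet-pv-2`, session g3; `--supports stmt-BirchSwinnertonDyer-14418`, helper); 0 classes
move. WHAT THIS IS. The sibling `Rank1ResidualJetTransverseFamily.lean` produces the local transverse
family and proves the reconciliation `hT` of `JET.tamagawaExponent_le_mInfty_of_kernelInputs` modulo
`hcompat` = gap G2 of the design note PV2-J6-S2-DESIGN: a homomorphism
`r : H¹(K_v, M) → H¹(L_{w'}, M)` with `r ∘ loc_v = loc_{w'} ∘ res_{L/K}` for a place `w'` of `L` over
the place `v` of `K`. This file PROVES G2 for every discrete Galois module `M` over a number field and
every finite extension `L/K` (`exists_localRestriction_compat`): the two routes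
`Γ_{L_{w'}} → Γ_L → Γ_K` and `Γ_{L_{w'}} → Γ_{K_v} → Γ_K` (the second along the local base change
`adicCompletionOfLiesOver`) are CONJUGATE in `Γ_K` (Langlands-side tree theorem
`exists_absGaloisRestrict_adicCompletion_eq_conj`, `ToLocalRestrictField.lean`), and an inner
automorphism acts trivially on `H¹` (the compatible pair `(Γ_{L_{w'}} → Γ_{K_v}, m ↦ τ m)` versus the
identity pair: the two pulled-back cocycles differ by the coboundary of `φ(τ)` — Serre, *Local Fields*
VII §5 Prop. 3). Consequence (sibling corollary file `Rank1ResidualJetTransverseFamilyInert.lean`,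
`exists_transverseFamily`): for a square-free conductor `c` whose prime factors are INERT in `K`
(Kolyvagin primes) the transverse family `𝒯` with the reconciliation `hT` EXISTS unconditionally — the
`𝒯`/`hT` inputs of the H63 assembly become kernel theorems.
References: [cite: SerreLocalFields1979, VII.§5 Prop. 3] [cite: SerreAbelianLadic1968, Ch. I §2.1]
[cite: Jetchev2008, §3.1.2 (p. 814)] [cite: MilneADT2006, I.§1].
-/

set_option autoImplicit false

noncomputable section

open scoped Classical

open IsDedekindDomain NumberField Field
  Literature.NumberTheory.GaloisRepresentations
  Literature.NumberTheory.GaloisRepresentations.DiscreteGaloisModule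
  Literature.NumberTheory.Automorphic Literature

namespace Summit.BirchSwinnertonDyer.Rank1Residual.JET

/-! ## §1 G2: restriction on local cohomology along `K_v ⊆ L_{w'}` -/

section G2

variable {K : Type} [Field K] [NumberField K] {M : Type} [AddCommGroup M] [TopologicalSpace M]
  [DiscreteTopology M]

/-- **Functoriality of restriction on local cohomology (gap G2).** For a discrete `Γ_K`-module `M`
over a number field `K`, a finite extension `L/K` (a number field with `Algebra K L`), a place `v` of
`K` and a place `w'` of `L` over it, there is a homomorphism `r : H¹(K_v, M) → H¹(L_{w'}, M)` with
`r (loc_v x) = loc_{w'} (res_{L/K} x)` for every `x ∈ H¹(K, M)` — `r` is restriction along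
`Γ_{L_{w'}} → Γ_{K_v}` (the local base change `K_v → L_{w'}`) twisted by the element `τ ∈ Γ_K`
conjugating the two routes `Γ_{L_{w'}} → Γ_K`; on `H¹` the twist is invisible (coboundary of `φ(τ)`).
[cite: SerreLocalFields1979, VII.§5 Prop. 3] [cite: SerreAbelianLadic1968, Ch. I §2.1] -/
theorem exists_localRestriction_compat (ρ : DiscreteGaloisModule K M)
    (L : Type) [Field L] [NumberField L] [Algebra K L]
    (v : HeightOneSpectrum (𝓞 K)) (w : HeightOneSpectrum (𝓞 L)) [w.asIdeal.LiesOver v.asIdeal] :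
    ∃ r : galoisCohomology (ρ.toLocal (Sum.inr v : Place K)) 1 →+
        galoisCohomology (DiscreteGaloisModule.toLocal (ρ.restrictField L) (Sum.inr w : Place L)) 1,
      ∀ x : galoisCohomology ρ 1,
        r (galoisCohomology.localization ρ (Sum.inr v) 1 x) =
          galoisCohomology.localization (ρ.restrictField L) (Sum.inr w) 1
            (galoisCohomology.res ρ L 1 x) := by
  letI := (adicCompletionOfLiesOver K L v w).toAlgebra
  obtain ⟨τ, hτ⟩ := exists_absGaloisRestrict_adicCompletion_eq_conj (F := K) (E := L) v w
  -- the two routes `Γ_{L_w} → Γ_K`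
  let f₁ : absoluteGaloisGroup (w.adicCompletion L) →ₜ* absoluteGaloisGroup K :=
    (absGaloisRestrict K L).comp (absGaloisRestrict L (w.adicCompletion L))
  let θ : absoluteGaloisGroup (w.adicCompletion L) →ₜ* absoluteGaloisGroup (v.adicCompletion K) :=
    absGaloisRestrict (v.adicCompletion K) (w.adicCompletion L)
  let f₂ : absoluteGaloisGroup (w.adicCompletion L) →ₜ* absoluteGaloisGroup K :=
    (absGaloisRestrict K (v.adicCompletion K)).comp θ
  have hconj : ∀ σ, f₁ σ = τ * f₂ σ * τ⁻¹ := fun σ ↦ hτ σ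
  have hconj' : ∀ σ, f₁ σ * τ = τ * f₂ σ := fun σ ↦ by
    rw [hconj σ, inv_mul_cancel_right]
  -- the topological representations
  let X : TopRep ℤ (absoluteGaloisGroup (v.adicCompletion K)) :=
    DiscreteGaloisModule.toTopRep (ρ.toLocal (Sum.inr v : Place K))
  let Y : TopRep ℤ (absoluteGaloisGroup (w.adicCompletion L)) :=
    DiscreteGaloisModule.toTopRep (DiscreteGaloisModule.toLocal (ρ.restrictField L) (Sum.inr w : Place L))
  have hX : ∀ g, X.ρ g = ρ.toTopRep.ρ (absGaloisRestrict K (v.adicCompletion K) g) := fun _ ↦ rfl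
  have hY : ∀ g, Y.ρ g = ρ.toTopRep.ρ (f₁ g) := fun _ ↦ rfl
  -- `ρ (a b) m = ρ a (ρ b m)`
  have hmul : ∀ (a b : absoluteGaloisGroup K) (m : M),
      ρ.toTopRep.ρ (a * b) m = ρ.toTopRep.ρ a (ρ.toTopRep.ρ b m) := fun a b m ↦ by
    rw [map_mul]; rfl
  -- the compatible pair `(θ, ρ(τ))`
  let ψ : TopRep.res (θ : absoluteGaloisGroup (w.adicCompletion L) →* _) X ⟶ Y :=
    TopRep.ofHom
      { toContinuousLinearMap := ρ.toTopRep.ρ τ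
        isIntertwining' := fun g ↦ ContinuousLinearMap.ext fun m ↦ by
          change ρ.toTopRep.ρ τ (X.ρ (θ g) m) = Y.ρ g (ρ.toTopRep.ρ τ m)
          rw [hX, hY, ← hmul, ← hmul]
          exact congrArg (fun t ↦ ρ.toTopRep.ρ t m) (hconj' g).symm }
  refine ⟨(ContinuousCohomology.map θ ψ 1).hom.toLinearMap.toAddMonoidHom, fun x ↦ ?_⟩
  obtain ⟨φ, rfl⟩ := oneCocycleClass_surjective ρ.toTopRep x
  -- unfold the three maps on cocycles
  have hloc : galoisCohomology.localization ρ (Sum.inr v) 1 (oneCocycleClass _ φ) =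
      oneCocycleClass X (contOneCocycles.pullback (absGaloisRestrict K (v.adicCompletion K))
        (TopRep.ofHom ⟨ContinuousLinearMap.id ℤ M, fun _ => rfl⟩) φ) :=
    map_oneCocycleClass _ _ _ φ
  have hres : galoisCohomology.localization (ρ.restrictField L) (Sum.inr w) 1
        (galoisCohomology.res ρ L 1 (oneCocycleClass _ φ)) =
      oneCocycleClass Y (contOneCocycles.pullback (absGaloisRestrict L (w.adicCompletion L))
        (TopRep.ofHom ⟨ContinuousLinearMap.id ℤ M, fun _ => rfl⟩)
        (contOneCocycles.pullback (absGaloisRestrict K L)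
          (TopRep.ofHom ⟨ContinuousLinearMap.id ℤ M, fun _ => rfl⟩) φ)) := by
    change galoisCohomology.localization (ρ.restrictField L) (Sum.inr w) 1
      (ContinuousCohomology.map _ _ 1 (oneCocycleClass _ φ)) = _
    rw [map_oneCocycleClass]
    exact map_oneCocycleClass _ _ _ _
  rw [hloc, hres]
  change ContinuousCohomology.map θ ψ 1 (oneCocycleClass X _) = _
  rw [map_oneCocycleClass]
  rw [← sub_eq_zero, ← oneCocycleClass_sub]
  refine (oneCocycleClass_eq_zero_iff _ _).mpr ⟨φ.1 τ, fun g ↦ ?_⟩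
  rw [Submodule.coe_sub, ContinuousMap.sub_apply, contOneCocycles.pullback_apply,
    contOneCocycles.pullback_apply, contOneCocycles.pullback_apply, contOneCocycles.pullback_apply]
  change ρ.toTopRep.ρ τ (φ.1 (f₂ g)) - φ.1 (f₁ g) = Y.ρ g (φ.1 τ) - φ.1 τ
  rw [hY, hconj g]
  -- `φ(τ g τ⁻¹) = φ τ + τ φ g - (τ g τ⁻¹) φ τ`
  have hinv : ρ.toTopRep.ρ τ (φ.1 τ⁻¹) = -φ.1 τ := by
    have h := φ.2 τ τ⁻¹
    rw [mul_inv_cancel, contOneCocycles.apply_one] at h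
    exact (neg_eq_of_add_eq_zero_right h.symm).symm
  have h1 : φ.1 (τ * f₂ g * τ⁻¹) = φ.1 (τ * f₂ g) + ρ.toTopRep.ρ (τ * f₂ g) (φ.1 τ⁻¹) := φ.2 _ _
  have h2 : φ.1 (τ * f₂ g) = φ.1 τ + ρ.toTopRep.ρ τ (φ.1 (f₂ g)) := φ.2 _ _
  have h3 : ρ.toTopRep.ρ (τ * f₂ g) (φ.1 τ⁻¹) = -(ρ.toTopRep.ρ (τ * f₂ g * τ⁻¹) (φ.1 τ)) := by
    rw [← map_neg, ← hinv, ← hmul, inv_mul_cancel_right]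
  rw [h1, h2, h3]
  abel

end G2


end Summit.BirchSwinnertonDyer.Rank1Residual.JET

end
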